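import Summits.BirchSwinnertonDyer.Rank1Residual.GaloisImage.SmallImageNiveauDichotomy
import Summits.BirchSwinnertonDyer.Rank1Residual.Additive.TwistedOrdinaryLineOfTwist
import Literature.NumberTheory.EllipticCurves.SerreOpenImageDeterminantProofs
import Literature.NumberTheory.GaloisRepresentations.ArtinLFunctionDirichletProofs
import Literature.NumberTheory.GaloisRepresentations.RatPlaceTwoProofs
import HarnessLib

/-!
# `(p − 1) ∣ e_p` for EVERY `E/ℚ` and EVERY prime `p`; `e_p = p − 1` EXACTLY on the inertia-split
# (TAME) rows — O8-TAME part 8: the general-`p` half of GEN 8's optional item (vi)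
# (cell `b2b-bsdres`, lane CLASS-CLOSURE, seat cc-typer-1 = typer of record N11 / O8, GEN 9; joint
# small-image axis O8 / N2 / N3; sub-partition key `e_p = #ρ̄_{E,p}(I_𝔓)` of O8/SUBPARTITION-typed)

HONEST FRAMING (cell `b2b-bsdres`, run/shared/lean/b2b/bsd-rank1-residual/, verbatim in every
file): the goal of the cell is to DELETE the COMBINATION-SHAPED residual classes of the
Birch–Swinnerton-Dyer formula for ALL analytic-rank `≤ 1` elliptic curves over `ℚ` — "full BSD
formula for every rank `≤ 1` curve in class `C`" assembled STRICTLY from published theorems — so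
that the rank-`≤ 1` remainder becomes exactly the CONSTRUCTION-SHAPED classes, which are TYPED
(missing-input `Prop`s), NOT attempted. This is not "finishing BSD". Lane CLASS-CLOSURE: research
routes, no claim beyond the stated classes; census output = EVIDENCE, never a Literature fact;
NOTHING is booked here. THEOREMS ONLY: no definition, no named fact, no conjecture, no `sorry`.

## What and why

GEN 8 proved, at an inertia group `I_𝔓` (`𝔓 ∣ p`) of `Γ_ℚ` acting on `E[p]`: `p ∤ e_p ⟹ ρ̄(I_𝔓)`
cyclic with a tame generator (`SmallImageCyclicInertia`), a STABLE PAIR forces `e_p ∣ p − 1`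
(`card_inertia_map_dvd_sub_one_of_stablePair`), and at `p = 3`: `3 ∤ e₃ ⟹ e₃ ∈ {2, 8}` with
`e₃ = 2 ⟺ InertiaSplitAt` (`SmallImageNiveauDichotomy`). The converse divisibility was left as
GEN 8's item (vi): it needs the mod-`p` cyclotomic character to be ONTO `𝔽_pˣ` on the inertia group
AT `p` (`ℚ(ζ_p)/ℚ` totally ramified at `p`). The tree has exactly that
(`exists_mem_inertia_modNCyclotomicCharacter_eq`, level `p`), and `det ρ̄_{E,p} = χ̄_p` in a frame
(`WeierstrassCurve.exists_frame_galoisRepTorsion_rat`, Weil pairing). Hence: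

* §1 `exists_mem_inertia_modPCyclotomicCharacterZMod_eq` — **`χ̄_p(I_𝔓) = 𝔽_pˣ`** for every prime
  `p` and every prime `𝔓` of `\bar ℤ` above `p` (GEN 8's `…_three_ne_one`, all `p`, all values).
* §2 **`sub_one_dvd_card_inertia_map_galoisRepTorsion`** — `(p − 1) ∣ e_p = #ρ̄_{E,p}(I_𝔓)` for
  EVERY elliptic curve `E/ℚ` and EVERY `p` (the subgroup `ρ̄(I_𝔓) ≤ Aut(E[p])` maps ONTO `𝔽_pˣ` under
  `det ∘ Φ`, so `p − 1 = #𝔽_pˣ` divides its order, `Subgroup.card_map_dvd`).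
* §3 **`card_inertia_map_eq_sub_one_of_stablePair`** / **`…_of_inertiaSplitAt`** — on a stable pair,
  in particular on every inertia-split (TAME, `ρ̄|_{I_𝔓} ≅ χ ⊕ 1`) row, **`e_p = p − 1` EXACTLY**
  (niveau 1); O8 forms **`O8.card_inertia_map_eq_sub_one_of_twistedOrdinaryLineAt`** (an O8 pair
  with a twisted-ordinary line at `I_𝔓`: `e_p = p − 1`) and, at `3`, the (M)/`I₀*` rows by name:
  **`card_inertia_map_three_eq_two_of_classX4Gord_of_not_surj`** (unconditional) — consistent with
  GEN 8's dichotomy (`e₃ = 2`), now reached without the `3 ∤ e₃` detour.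

Sub-partition reading (O8/SUBPARTITION-typed v1.9): the key `e_p` takes the single value `p − 1` on
the TAME cell at every `p` (3Ns: 2; 5Ns/5Nn/5S4 split rows: 4; 7Ns: 6; 13S4: 12), and is a multiple
of `p − 1` prime to `p` on the rest of O8 (at `3`: `8`). Nothing about BSD_p; no mark moved.

References: [Serre1972] §1.3, §1.11, §5.2 (iii); [SerreLocalFields1979] Ch. IV §2 Cor. 1–3, §4
Prop. 17–18; [SilvermanAEC2009] III.8 (Weil pairing); Washington GTM 83 Lemma 1.4 / Prop. 2.3
(`p` totally ramified in `ℚ(ζ_p)`); class-closure/O8/STATEMENT.md §§13–19.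
-/

set_option autoImplicit false

noncomputable section

open scoped Classical NumberField

open Field IsDedekindDomain NumberField WeierstrassCurve
  Literature.NumberTheory.EllipticCurves Literature.NumberTheory.GaloisRepresentations
  Rat.HeightOneSpectrum
  Literature.NumberTheory.EllipticCurves.Rank1Residual
  Summit.BirchSwinnertonDyer.Rank1Residual.Additive.MixedCongruence

namespace Summit.BirchSwinnertonDyer.Rank1Residual.GaloisImage

/-! ## §1. `χ̄_p(I_𝔓) = 𝔽_pˣ`: the mod-`p` cyclotomic character is onto on inertia AT `p` -/

section Cyclotomic

variable (p : ℕ) [hp : Fact p.Prime]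

/-- **`χ̄_p(I_𝔓) = 𝔽_pˣ`.** For the place `v ∋ p` of `ℚ` and any prime `𝔓` of `\bar ℤ` above `v`,
every unit `u ∈ 𝔽_pˣ` is the mod-`p` cyclotomic character of some `τ ∈ I_𝔓` (`p` is totally ramified
in `ℚ(ζ_p)`: the tree's `exists_mem_inertia_modNCyclotomicCharacter_eq` at level `p = p¹·1`).
[cite: Washington1997, Ch. 2 Prop. 2.3 and Lemma 1.4] [cite: SerreLocalFields1979, Ch. IV §4 Prop. 17–18] -/
theorem exists_mem_inertia_modPCyclotomicCharacterZMod_eq {v : HeightOneSpectrum (𝓞 ℚ)}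
    (hv : ((p : ℕ) : 𝓞 ℚ) ∈ v.asIdeal) {𝔓 : Ideal (absIntegers (𝓞 ℚ) ℚ)} (h𝔓 : 𝔓 ∈ v.primesAbove)
    (u : (ZMod p)ˣ) :
    ∃ τ ∈ 𝔓.inertia (absoluteGaloisGroup ℚ), modPCyclotomicCharacterZMod ℚ p τ = u := by
  haveI : NeZero p := ⟨hp.out.ne_zero⟩
  have hvgen : natGenerator v = p := Rat.natGenerator_eq_of_prime_mem v hp.out hv
  have hm : p = p ^ (0 + 1) * 1 := by rw [zero_add, pow_one, mul_one]
  have ha : ZMod.unitsMap (Dvd.intro_left _ hm.symm) u = 1 :=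
    Units.ext (Subsingleton.elim (α := ZMod 1) _ _)
  obtain ⟨τ, hτ, hχ⟩ :=
    exists_mem_inertia_modNCyclotomicCharacter_eq hm hp.out.not_dvd_one hvgen h𝔓 ha
  refine ⟨τ, hτ, ?_⟩
  rw [modPCyclotomicCharacterZMod_eq_modNCyclotomicCharacter]
  exact hχ

end Cyclotomic

/-! ## §2. `(p − 1) ∣ e_p` for every `E/ℚ`, every `p` -/

section Order

variable (W : WeierstrassCurve ℚ) [W.IsElliptic] (p : ℕ) [hp : Fact p.Prime]

/-- **`(p − 1) ∣ e_p`.** For every elliptic curve `E/ℚ`, every prime `p` and every prime `𝔓` of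
`\bar ℤ` above `p`, `p − 1` divides `e_p = #ρ̄_{E,p}(I_𝔓)`: in a frame `Φ : Aut(E[p]) ≅ GL₂(𝔽_p)`
one has `det Φ(ρ̄ σ) = χ̄_p(σ)` (Weil pairing, `exists_frame_galoisRepTorsion_rat`), `χ̄_p` maps `I_𝔓`
ONTO `𝔽_pˣ` (§1), so `det ∘ Φ` maps the finite group `ρ̄(I_𝔓)` onto `𝔽_pˣ`, whose order `p − 1`
therefore divides `#ρ̄(I_𝔓)` (`Subgroup.card_map_dvd`). [cite: Serre1972, §1.3 and §1.11]
[cite: SilvermanAEC2009, III.8 Prop. 8.1 and remark (det ρ̄ = χ̄)] -/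
theorem sub_one_dvd_card_inertia_map_galoisRepTorsion {v : HeightOneSpectrum (𝓞 ℚ)}
    (hv : ((p : ℕ) : 𝓞 ℚ) ∈ v.asIdeal) {𝔓 : Ideal (absIntegers (𝓞 ℚ) ℚ)} (h𝔓 : 𝔓 ∈ v.primesAbove) :
    p - 1 ∣ Nat.card ((𝔓.inertia (absoluteGaloisGroup ℚ)).map (galoisRepTorsion W p)) := by
  haveI : NeZero p := ⟨hp.out.ne_zero⟩
  obtain ⟨e, Φ, -, -, hdet, -, -⟩ := exists_frame_galoisRepTorsion_rat W p
  set D : Multiplicative (AddAut (geomTorsion W p)) →* (ZMod p)ˣ :=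
    (Matrix.GeneralLinearGroup.det : GL (Fin 2) (ZMod p) →* (ZMod p)ˣ).comp Φ.toMonoidHom with hD
  have hDρ : ∀ σ : absoluteGaloisGroup ℚ, D (galoisRepTorsion W p σ) =
      modPCyclotomicCharacterZMod ℚ p σ := fun σ ↦ by
    rw [hD, MonoidHom.comp_apply, MulEquiv.coe_toMonoidHom]
    exact hdet σ
  have htop : ((𝔓.inertia (absoluteGaloisGroup ℚ)).map (galoisRepTorsion W p)).map D = ⊤ := by
    refine top_unique fun u _ ↦ ?_
    obtain ⟨τ, hτ, hχ⟩ := exists_mem_inertia_modPCyclotomicCharacterZMod_eq p hv h𝔓 u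
    exact ⟨galoisRepTorsion W p τ, Subgroup.mem_map_of_mem _ hτ, (hDρ τ).trans hχ⟩
  have h :=
    Subgroup.card_map_dvd (H := (𝔓.inertia (absoluteGaloisGroup ℚ)).map (galoisRepTorsion W p)) D
  rwa [htop, Subgroup.card_top, Nat.card_eq_fintype_card, ZMod.card_units] at h

/-! ## §3. `e_p = p − 1` EXACTLY on a stable pair / an inertia-split (TAME) row -/

variable {W p}

/-- **Stable pair ⟹ `e_p = p − 1` EXACTLY** (niveau 1): GEN 8's `e_p ∣ p − 1`
(`card_inertia_map_dvd_sub_one_of_stablePair`) and §2's `(p − 1) ∣ e_p`.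
[cite: Serre1972, §1.3 and §1.11] [cite: SerreLocalFields1979, Ch. IV §2 Cor. 1–3] -/
theorem card_inertia_map_eq_sub_one_of_stablePair {v : HeightOneSpectrum (𝓞 ℚ)}
    (hv : ((p : ℕ) : 𝓞 ℚ) ∈ v.asIdeal) {𝔓 : Ideal (absIntegers (𝓞 ℚ) ℚ)} (h𝔓 : 𝔓 ∈ v.primesAbove)
    (h : ∃ X Y : AddSubgroup (geomTorsion W (p : ℤ)), Nat.card X = p ∧ Nat.card Y = p ∧
      X ⊓ Y = ⊥ ∧ X ⊔ Y = ⊤ ∧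
      (∀ σ ∈ 𝔓.inertia (absoluteGaloisGroup ℚ), ∀ P ∈ X, σ • P ∈ X) ∧
      (∀ σ ∈ 𝔓.inertia (absoluteGaloisGroup ℚ), ∀ P ∈ Y, σ • P ∈ Y)) :
    Nat.card ((𝔓.inertia (absoluteGaloisGroup ℚ)).map (galoisRepTorsion W p)) = p - 1 :=
  Nat.dvd_antisymm (card_inertia_map_dvd_sub_one_of_stablePair hv h𝔓 h)
    (sub_one_dvd_card_inertia_map_galoisRepTorsion W p hv h𝔓)

/-- **Inertia-split (TAME) row ⟹ `e_p = p − 1` EXACTLY**: `E[p] = X ⊕ Y` with `X` `I_𝔓`-stable and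
`Y` `I_𝔓`-fixed is a stable pair. The O8 sub-partition key `e_p` takes the single value `p − 1` on
the TAME cell, at every `p`. [cite: Serre1972, §1.3 and §1.11]
[cite: Edixhoven1997Serre, §4.2 (PDF p. 297; companion forms)] -/
theorem card_inertia_map_eq_sub_one_of_inertiaSplitAt {v : HeightOneSpectrum (𝓞 ℚ)}
    (hv : ((p : ℕ) : 𝓞 ℚ) ∈ v.asIdeal) {𝔓 : Ideal (absIntegers (𝓞 ℚ) ℚ)} (h𝔓 : 𝔓 ∈ v.primesAbove)
    (h : InertiaSplitAt W p (𝔓.inertia (absoluteGaloisGroup ℚ))) :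
    Nat.card ((𝔓.inertia (absoluteGaloisGroup ℚ)).map (galoisRepTorsion W p)) = p - 1 := by
  obtain ⟨X, Y, hX, hY, hinf, hsup, hXst, hYfix⟩ := h
  exact card_inertia_map_eq_sub_one_of_stablePair hv h𝔓
    ⟨X, Y, hX, hY, hinf, hsup, hXst, fun σ hσ P hP ↦ by rw [hYfix σ hσ P hP]; exact hP⟩

/-- **O8: a twisted-ordinary line at `I_𝔓` forces `e_p = p − 1`.** An O8 pair at `p` (`ClassX4 W p`,
`ρ̄_{E,p}` not onto) whose `E[p]` has the twisted-ordinary shape at `I_𝔓` is inertia-split there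
(GEN 7 `O8.inertiaSplitAt_of_twistedOrdinaryLineAt`), hence `e_p = p − 1`.
[cite: Serre1972, §1.11 Prop. 11 and §2.4 Prop. 15] -/
theorem O8.card_inertia_map_eq_sub_one_of_twistedOrdinaryLineAt (hX : ClassX4 W p) (hns : ¬ Surj W p)
    {v : HeightOneSpectrum (𝓞 ℚ)} (hv : ((p : ℕ) : 𝓞 ℚ) ∈ v.asIdeal)
    {𝔓 : Ideal (absIntegers (𝓞 ℚ) ℚ)} (h𝔓 : 𝔓 ∈ v.primesAbove)
    (hE : TwistedOrdinaryLineAt W p (𝔓.inertia (absoluteGaloisGroup ℚ))) :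
    Nat.card ((𝔓.inertia (absoluteGaloisGroup ℚ)).map (galoisRepTorsion W p)) = p - 1 :=
  card_inertia_map_eq_sub_one_of_inertiaSplitAt hv h𝔓
    (Additive.O8.inertiaSplitAt_of_twistedOrdinaryLineAt W p hX hns hE)

/-- **O8 ∩ X4♯(G-ord) ∩ `I₀*` at `3`: `e₃ = 2`, unconditionally and directly** (GEN 7's binder-free
TAME theorem `inertiaSplitAt_three_of_classX4Gord_of_not_surj` + §3; GEN 8 reached the same value
through the dichotomy `3 ∤ e₃ ⟹ e₃ ∈ {2, 8}`). [cite: Serre1972, §1.11 Prop. 11 and §2.4 Prop. 15] -/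
theorem card_inertia_map_three_eq_two_of_classX4Gord_of_not_surj [W.IsGloballyMinimal]
    (hX : Additive.ClassX4Gord W 3) (he : Additive.semistabilityIndex W 3 = 2) (hns : ¬ Surj W 3)
    {v : HeightOneSpectrum (𝓞 ℚ)} (hv : ((3 : ℕ) : 𝓞 ℚ) ∈ v.asIdeal)
    {𝔓 : Ideal (absIntegers (𝓞 ℚ) ℚ)} (h𝔓 : 𝔓 ∈ v.primesAbove) :
    Nat.card ((𝔓.inertia (absoluteGaloisGroup ℚ)).map (galoisRepTorsion W 3)) = 2 :=
  card_inertia_map_eq_sub_one_of_inertiaSplitAt hv h𝔓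
    (inertiaSplitAt_three_of_classX4Gord_of_not_surj hX he hns hv h𝔓)

end Order

end Summit.BirchSwinnertonDyer.Rank1Residual.GaloisImage

end
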